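import Literature.MathematicalPhysics.QuantumLattice.SectorisedIncrementBoundGradedWeightedOrientedGeneric
import Literature.MathematicalPhysics.QuantumLattice.SectorisedKernelNormOrientedBridge
import HarnessLib

/-!
# The orders `≥ 2` of the sectorised single-scale INCREMENT, GRADED, DECAY-WEIGHTED, fine output legs PRESCRIBED, ORIENTED tree lines:
# plateau transport (the levelled track of the levels tower)

Topic `Literature/MathematicalPhysics/QuantumLattice`; the oriented twin of §2 of `SectorisedIncrementBoundGradedWeightedPrescribedPlateau`
(Benfatto–Giuliani–Mastropietro 2006, (2.61)–(2.63), (2.66), §2.8 (2.82)–(2.84), (2.88)–(2.90), (2.97)–(2.98), App. A3 Lemma A3.1,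
App. A4 (A4.8), §3 (3.2)–(3.8)).  The generic oriented door with parent-set prescriptions
(`sum_filter_wt_norm_kernel_map_effAction_sub_gaussConv_le_graded_oriented_parents_of_gramBounded`) is fed, for the sector preimage
`Ṽ = sectorPreimage β F G`, by the two oriented bridges of `SectorisedKernelNormOrientedBridge` (full pin / position-only pin) and
transported to `G` by the plateau identities; the talking relation `ov` of the coarse sector legs, the levelled sizes `N(m′, L)`
dominating the two families of sectorised prescribed sums, and the oracle `Nφ` over the readings of the anchored trees are hypotheses.

* `sum_filter_wt_norm_sectorAnalysis_effAction_sub_gaussConv_le_graded_oriented_of_plateau` — the estimate.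

Everything is proved; no definition, no named fact.

## Sources

G. Benfatto, A. Giuliani, V. Mastropietro, Ann. Henri Poincaré 7 (2006) 809–898, (2.61)–(2.63), (2.66), (2.82)–(2.84), (2.88)–(2.90),
(2.97)–(2.98), App. A3 Lemma A3.1, App. A4 (A4.8), §3 (3.2)–(3.8) [`BenfattoGiulianiMastropietro2006`].
-/

noncomputable section

namespace Literature.MathematicalPhysics.QuantumLattice

open GrassmannAlgebra Finset Literature.Probability.LatticeModels Literature.Probability.LatticeModels.BattleFederbush
open scoped Nat

section Transfer

variable {L M : ℕ} [NeZero L] [NeZero M] {N N' : ℕ} {Λ : Type*} [DecidableEq Λ] {wt : Finset Λ → ℝ}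

/-- **The orders `≥ 2` of the increment of the sectorised kernels across one slice, GRADED, fine output legs PRESCRIBED, WEIGHTED output
positions, ORIENTED tree lines — the levelled track** (BGM 2006 (2.61)–(2.63), (2.66), §2.8 (2.82)–(2.84), (2.88)–(2.90), (2.97)–(2.98),
App. A3 Lemma A3.1, App. A4 (A4.8), §3).  Data as in `sum_filter_wt_norm_sectorAnalysis_effAction_sub_gaussConv_le_graded_prescribed_of_plateau`,
and moreover: a talking relation `ov` of the coarse sector legs with at most `c ≥ 1` partners supporting `S(F̃)ᵀ C S(F̃)`; levelled sizes
`N(m′, L) ≥ 0` dominating `ε_x·B(m′, F)` at level `F + 1` (full pin: `ε_x^{2m′−1} Σ_{σ′|_E = τ} Σ_{x′_q = y} wt·‖W_{F,σ′}(x′)‖ ≤ B m′ F`,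
`|E| = F + 1 ∋ q`) and `ε_x·B′(m′, F)` at level `F` (position-only pin: the same sums with `|E| = F ∌ t` and the pinned position any function
of the sector of the pinned leg, `≤ B′ m′ F`); oracles `Nφ n δ pf` over the readings of the anchored trees.  Then, the fine output legs
`j ∈ J` prescribed to `τ″ j` (parents `Par j`, at most `ρc` of them),
`Σ_{X″_p = w″, (X″_j).2 = τ″_j} wt(π″X″)·‖kernel (map (toLin' E(F′)) (effAction C G − e^{Δ_C}G)) (m+1) X″‖ ≤
cr·cc^m·(∏_{j∈J} |Par j|)·[graded-oriented + tail]`. [cite: BenfattoGiulianiMastropietro2006, (2.61)-(2.63), (2.66), (2.84), (2.88)-(2.90), (2.97)-(2.98), (A4.8), (3.2)-(3.8)] -/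
theorem sum_filter_wt_norm_sectorAnalysis_effAction_sub_gaussConv_le_graded_oriented_of_plateau
    (hwt : IsTreeWeight wt) (π : SpaceTimeIdx L M × SectorLeg N → Λ) (π'' : SpaceTimeIdx L M × SectorLeg N' → Λ)
    {β : ℝ} (hβ : 0 < β) (F Ft : Fin N → FreqMomentum L M → ℂ) (hFF : ∀ ω k, Ft ω k * F ω k = F ω k)
    (hF0 : ∀ k, ∑ ω, F ω k = 0 → ∀ ω, F ω k = 0)
    (F' : Fin N' → FreqMomentum L M → ℂ) (G : HubbardGrassmann L M) (hG : G ∈ evenPart ℂ (HubbardFieldIdx L M))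
    (hG0 : constPart ℂ G = 0)
    (C : Matrix (HubbardFieldIdx L M) (HubbardFieldIdx L M) ℂ)
    (hCpl : ∀ X Y, C X Y ≠ 0 → ∑ ω, F ω X.1.1 = 1 ∧ ∑ ω, F ω Y.1.1 = 1)
    (hF'pl : ∀ (ω' : Fin N') (k : FreqMomentum L M), F' ω' k ≠ 0 → ∑ ω, F ω k = 1)
    (child : Fin N' → Fin N → Prop) [DecidableRel child]
    (hvan : ∀ (X'' : SpaceTimeIdx L M × SectorLeg N') (X' : SpaceTimeIdx L M × SectorLeg N),
      (sectorAnalysisMatrix L M β F' * sectorSubMatrix L M β Ft) X'' X' ≠ 0 →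
        child X''.2.1.1 X'.2.1.1 ∧ X'.2.1.2 = X''.2.1.2 ∧ X'.2.2 = X''.2.2)
    (σdef : SectorLeg N) (ov : SectorLeg N → SectorLeg N → Prop) [DecidableRel ov] {c : ℕ} (hc1 : 1 ≤ c)
    (hov : ∀ σ' : SectorLeg N, (univ.filter fun σ : SectorLeg N => ov σ σ').card ≤ c)
    (hCov : ∀ X Y, ((sectorSubMatrix L M β Ft).transpose * C * sectorSubMatrix L M β Ft) X Y ≠ 0 → ov X.2 Y.2 ∧ ov Y.2 X.2)
    {κ : ℝ} (hκ : 0 < κ)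
    (hGB : IsGramBoundedR ((sectorSubMatrix L M β Ft).transpose * C * sectorSubMatrix L M β Ft) κ)
    (B B' : ℕ → ℕ → ℝ) (hB0 : ∀ m' Fc, 0 ≤ B m' Fc)
    (hB : ∀ (m' Fc : ℕ) (E : Finset (Fin (2 * m' + 1 + 1))) (τ : Fin (2 * m' + 1 + 1) → SectorLeg N) (q : Fin (2 * m' + 1 + 1)),
      q ∈ E → E.card = Fc + 1 → ∀ y : SpaceTimeIdx L M,
        imagTimeWeight β M ^ (2 * m' + 1) *
          ∑ σ ∈ univ.filter (fun σ : Fin (2 * m' + 1 + 1) → SectorLeg N => ∀ e ∈ E, σ e = τ e),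
            ∑ x ∈ univ.filter (fun x : Fin (2 * m' + 1 + 1) → SpaceTimeIdx L M => x q = y),
              wt ((univ.image fun i => (x i, σ i)).image π) * ‖sectorisedKernel L M β F G (2 * m' + 1 + 1) σ x‖ ≤ B (m' + 1) Fc)
    (hB' : ∀ (m' Fc : ℕ) (E : Finset (Fin (2 * m' + 1 + 1))) (τ : Fin (2 * m' + 1 + 1) → SectorLeg N) (t : Fin (2 * m' + 1 + 1)),
      t ∉ E → E.card = Fc → ∀ yσ : SectorLeg N → SpaceTimeIdx L M,
        imagTimeWeight β M ^ (2 * m' + 1) *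
          ∑ σ ∈ univ.filter (fun σ : Fin (2 * m' + 1 + 1) → SectorLeg N => ∀ e ∈ E, σ e = τ e),
            ∑ x ∈ univ.filter (fun x : Fin (2 * m' + 1 + 1) → SpaceTimeIdx L M => x t = yσ (σ t)),
              wt ((univ.image fun i => (x i, σ i)).image π) * ‖sectorisedKernel L M β F G (2 * m' + 1 + 1) σ x‖ ≤ B' (m' + 1) Fc)
    (Nl : ℕ → ℕ → ℝ) (hNl0 : ∀ m' Lv, 0 ≤ Nl m' Lv)
    (hBN : ∀ m' Fc, imagTimeWeight β M * B (m' + 1) Fc ≤ Nl (m' + 1) (Fc + 1))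
    (hB'N : ∀ m' Fc, imagTimeWeight β M * B' (m' + 1) Fc ≤ Nl (m' + 1) Fc)
    {m : ℕ} (p : Fin (m + 1)) (J : Finset (Fin (m + 1))) (hp : p ∉ J) (τ'' : Fin (m + 1) → SectorLeg N')
    (Nφ : (n : ℕ) → (Fin n → ℕ) → (J → Fin n) → ℝ) (hNφ0 : ∀ n δ pf, 0 ≤ Nφ n δ pf)
    (hNφ : ∀ (n : ℕ) (δ : Fin n → ℕ) (b : Fin n) {k : ℕ} (s : Script b k), s.Valid → univ.image s.y = univ → ∀ pf : J → Fin n,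
      ∃ o : Fin n → Bool, ∏ a, Nl (δ a) ((univ.filter fun j : J => pf j = a).card +
        swChildren s o a + if a = b ∨ o a = true then 1 else 0) ≤ Nφ n δ pf)
    {α : ℝ} (hα : 0 < α)
    (hrow : ∀ X, ∑ Y, ‖((sectorSubMatrix L M β Ft).transpose * C * sectorSubMatrix L M β Ft) X Y‖ * wt {π X, π Y} ≤ α)
    (hcol : ∀ Y, ∑ X, ‖((sectorSubMatrix L M β Ft).transpose * C * sectorSubMatrix L M β Ft) X Y‖ * wt {π X, π Y} ≤ α)
    {ρ : ℝ} (hρ : 0 < ρ)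
    (hθ : Real.exp 1 * α * normV (SpaceTimeIdx L M × SectorLeg N) κ ρ (fun m' => imagTimeWeight β M * B m' 0) / κ ^ 2 < 1)
    {cr cc : ℝ} (hcc0 : 0 ≤ cc)
    (hrow' : ∀ X'', ∑ X', ‖(sectorAnalysisMatrix L M β F' * sectorSubMatrix L M β Ft) X'' X'‖ * wt {π'' X'', π X'} ≤ cr)
    (hcol' : ∀ X', ∑ X'', ‖(sectorAnalysisMatrix L M β F' * sectorSubMatrix L M β Ft) X'' X'‖ * wt {π'' X'', π X'} ≤ cc)
    {N₀ : ℕ} (hN₀ : 2 ≤ N₀) (w'' : SpaceTimeIdx L M × SectorLeg N') :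
    ∑ X'' ∈ univ.filter (fun X'' : Fin (m + 1) → SpaceTimeIdx L M × SectorLeg N' => X'' p = w'' ∧ ∀ j ∈ J, (X'' j).2 = τ'' j),
        wt ((univ.image X'').image π'') *
          ‖kernel ℂ (ExteriorAlgebra.map (Matrix.toLin' (sectorAnalysisMatrix L M β F')) (effAction ℂ C G - gaussConv ℂ C G)) (m + 1) X''‖ ≤
      cr * cc ^ m * ((∏ j ∈ J, (((univ.filter fun ℓ' : SectorLeg N =>
          child (τ'' j).1.1 ℓ'.1.1 ∧ ℓ'.1.2 = (τ'' j).1.2 ∧ ℓ'.2 = (τ'' j).2).card : ℕ) : ℝ)) *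
        (∑ n ∈ Ico 2 N₀, (κ⁻¹ ^ (m + 1) * κ⁻¹ ^ (2 * (n - 1)) * ((c * α) ^ (n - 1) * Real.exp n)) *
            ∑ δ ∈ (Fintype.piFinset fun _ : Fin n => range (Fintype.card (SpaceTimeIdx L M × SectorLeg N) / 2 + 1)) with
                m + 1 + 2 * (n - 1) ≤ ∑ a, 2 * δ a,
              ∑ pf : J → Fin n, ((∏ j, ((2 * δ (pf j) : ℕ) : ℝ)) / ((∑ a, 2 * δ a : ℕ) : ℝ) ^ J.card) *
                ((Real.exp 3 * κ) ^ (∑ a, 2 * δ a) * Nφ n δ pf) +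
          ρ⁻¹ ^ (m + 1) * (Real.exp 1 * normV (SpaceTimeIdx L M × SectorLeg N) κ ρ (fun m' => imagTimeWeight β M * B m' 0)) *
            (Real.exp 1 * α * normV (SpaceTimeIdx L M × SectorLeg N) κ ρ (fun m' => imagTimeWeight β M * B m' 0) / κ ^ 2) ^ (N₀ - 1) /
            (1 - Real.exp 1 * α * normV (SpaceTimeIdx L M × SectorLeg N) κ ρ (fun m' => imagTimeWeight β M * B m' 0) / κ ^ 2))) := by
  classical
  have hε : 0 ≤ imagTimeWeight β M := imagTimeWeight_nonneg hβ.le M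
  -- the pulled-back weight on labelled positions is nonnegative
  have hwl : ∀ S : Finset (SpaceTimeIdx L M × SectorLeg N), 0 ≤ wt (S.image π) := fun S => zero_le_one.trans (hwt.one_le _)
  -- the parents of a fine label
  set Par : Fin (m + 1) → Finset (SectorLeg N) := fun j =>
    univ.filter fun ℓ' : SectorLeg N => child (τ'' j).1.1 ℓ'.1.1 ∧ ℓ'.1.2 = (τ'' j).1.2 ∧ ℓ'.2 = (τ'' j).2 with hPar
  -- plain weighted anchored norms of the preimage (tail)
  have hNplain : ∀ (m' : ℕ) (j : Fin (2 * m')) (w : SpaceTimeIdx L M × SectorLeg N),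
      ∑ Y ∈ univ.filter (fun Y : Fin (2 * m') → SpaceTimeIdx L M × SectorLeg N => Y j = w),
        ‖kernel ℂ (sectorPreimage β F G) (2 * m') Y‖ * wt ((univ.image Y).image π) ≤ imagTimeWeight β M * B m' 0 := by
    intro m'
    rcases m' with _ | m'
    · intro j; exact Fin.elim0 (Fin.cast (Nat.mul_zero 2) j)
    · rw [show 2 * (m' + 1) = 2 * m' + 1 + 1 by ring]
      intro j w
      have h := sum_wt_restr_norm_kernel_sectorPreimage_le_of_wt_prescribedSum_le hβ.le F G (fun S => wt (S.image π)) hwl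
        (2 * m' + 1) (Fc := 0) (B := B (m' + 1) 0) (fun E τ q hq hE y => hB m' 0 E τ q hq hE y) (fun _ => none)
        (by simp) j rfl w
      refine le_trans (le_of_eq (sum_congr rfl fun Y _ => ?_)) h
      rw [if_pos (fun j' σ h' => by simp at h')]
  -- the levelled hypotheses of the preimage: full pin and position-only pin (the two oriented bridges)
  have hN : ∀ (m' : ℕ) (ρc : Fin (2 * m') → Option (SectorLeg N)) (t : Fin (2 * m')), ρc t = none →
      ∀ a : SpaceTimeIdx L M × SectorLeg N,
      ∑ Y ∈ univ.filter (fun Y : Fin (2 * m') → SpaceTimeIdx L M × SectorLeg N => Y t = a),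
        (if ∀ j' σ, ρc j' = some σ → (Y j').2 = σ then ‖kernel ℂ (sectorPreimage β F G) (2 * m') Y‖ * wt ((univ.image Y).image π)
          else 0) ≤ Nl m' ((univ.filter fun j' : Fin (2 * m') => ρc j' ≠ none).card + 1) := by
    intro m'
    rcases m' with _ | m'
    · intro ρc t; exact Fin.elim0 (Fin.cast (Nat.mul_zero 2) t)
    · rw [show 2 * (m' + 1) = 2 * m' + 1 + 1 by ring]
      intro ρc t ht a
      exact (sum_wt_restr_norm_kernel_sectorPreimage_le_of_wt_prescribedSum_le hβ.le F G (fun S => wt (S.image π)) hwl (2 * m' + 1)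
        (B := B (m' + 1) _) (fun E τ q hq hE y => hB m' _ E τ q hq hE y) ρc rfl t ht a).trans (hBN m' _)
  have hNsw : ∀ (m' : ℕ) (ρc : Fin (2 * m') → Option (SectorLeg N)) (t : Fin (2 * m')), ρc t = none →
      ∃ g₀ : SectorLeg N → ℝ, (∀ σ, 0 ≤ g₀ σ) ∧
      (∀ a : SpaceTimeIdx L M × SectorLeg N,
        ∑ Y ∈ univ.filter (fun Y : Fin (2 * m') → SpaceTimeIdx L M × SectorLeg N => Y t = a),
          (if ∀ j' σ, ρc j' = some σ → (Y j').2 = σ then ‖kernel ℂ (sectorPreimage β F G) (2 * m') Y‖ * wt ((univ.image Y).image π)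
            else 0) ≤ g₀ a.2) ∧
      ∑ σ, g₀ σ ≤ Nl m' (univ.filter fun j' : Fin (2 * m') => ρc j' ≠ none).card := by
    intro m'
    rcases m' with _ | m'
    · intro ρc t; exact Fin.elim0 (Fin.cast (Nat.mul_zero 2) t)
    · rw [show 2 * (m' + 1) = 2 * m' + 1 + 1 by ring]
      intro ρc t ht
      obtain ⟨g₀, hg0, hgpt, hgsum⟩ := exists_sectorSum_bound_kernel_sectorPreimage_of_wt_swPrescribedSum_le hβ.le F G
        (fun S => wt (S.image π)) hwl (2 * m' + 1) (B' := B' (m' + 1) _) σdef (fun E τ t' ht' hE yσ => hB' m' _ E τ t' ht' hE yσ)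
        ρc rfl t ht
      exact ⟨g₀, hg0, hgpt, hgsum.trans (hB'N m' _)⟩
  -- the inherited predicates: a fine label only overlaps its parents
  have hPA : ∀ j ∈ J, ∀ (y'' : SpaceTimeIdx L M × SectorLeg N') (x' : SpaceTimeIdx L M × SectorLeg N),
      (fun (j : Fin (m + 1)) (X'' : SpaceTimeIdx L M × SectorLeg N') => X''.2 = τ'' j) j y'' →
        (LinearMap.toMatrix' (Matrix.toLin' (sectorAnalysisMatrix L M β F')) *
            LinearMap.toMatrix' (Matrix.toLin' (sectorSubMatrix L M β Ft))) y'' x' ≠ 0 → x'.2 ∈ Par j := by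
    intro j _ y'' x' hPj hne
    rw [LinearMap.toMatrix'_toLin', LinearMap.toMatrix'_toLin'] at hne
    obtain ⟨h1, h2, h3⟩ := hvan y'' x' hne
    have hPj' : y''.2 = τ'' j := hPj
    simp only [hPar, mem_filter, mem_univ, true_and, ← hPj']
    exact ⟨h1, h2, h3⟩
  -- transfer from `map S Ṽ` to `G` (plateau identities)
  have hea := map_sectorAnalysis_effAction_map_sectorPreimage_of_plateau hβ.ne' F Ft hFF hF0 F' G C hCpl hF'pl
  have hgc := map_sectorAnalysis_gaussConv_map_sectorPreimage_of_plateau hβ.ne' F Ft hFF hF0 F' G C hCpl hF'pl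
  have hrepl : ExteriorAlgebra.map (Matrix.toLin' (sectorAnalysisMatrix L M β F')) (effAction ℂ C G - gaussConv ℂ C G) =
      ExteriorAlgebra.map (Matrix.toLin' (sectorAnalysisMatrix L M β F'))
        (effAction ℂ C (ExteriorAlgebra.map (Matrix.toLin' (sectorSubMatrix L M β Ft)) (sectorPreimage β F G)) -
          gaussConv ℂ C (ExteriorAlgebra.map (Matrix.toLin' (sectorSubMatrix L M β Ft)) (sectorPreimage β F G))) := by
    rw [map_sub, map_sub, hea, hgc]
  rw [hrepl]
  exact sum_filter_wt_norm_kernel_map_effAction_sub_gaussConv_le_graded_oriented_parents_of_gramBounded hwt π π'' C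
    (Matrix.toLin' (sectorSubMatrix L M β Ft)) (Matrix.toLin' (sectorAnalysisMatrix L M β F')) (sectorPreimage β F G)
    (sectorPreimage_mem_evenPart β F hG) (by rw [constPart_sectorPreimage, hG0]) hκ (by simpa only [LinearMap.toMatrix'_toLin'] using hGB)
    Prod.snd ov hc1 hov (by simpa only [LinearMap.toMatrix'_toLin'] using hCov)
    p J hp (fun j X'' => X''.2 = τ'' j) Par hPA (fun m' => imagTimeWeight β M * B m' 0) (fun m' => mul_nonneg hε (hB0 _ _)) hNplain
    Nl hNl0 hN hNsw Nφ hNφ0 hNφ hα (by simpa only [LinearMap.toMatrix'_toLin'] using hrow)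
    (by simpa only [LinearMap.toMatrix'_toLin'] using hcol) hρ hθ hcc0 (by simpa only [LinearMap.toMatrix'_toLin'] using hrow')
    (by simpa only [LinearMap.toMatrix'_toLin'] using hcol') hN₀ w''

end Transfer

end Literature.MathematicalPhysics.QuantumLattice
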